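import Summits.BirchSwinnertonDyer.Rank1Residual.X11b.HalvesReceptacle
import HarnessLib
import HarnessLib.Audit.Tags

/-!
# Route `SchneiderFreeAdditiveX3` (K1 door), crux `GordTwoBranchIMC` (stmt-BirchSwinnertonDyer-19177):
# VALUE TRANSFER between two frames generating the same ideal of `R₀⟦T⟧`

Cell `bsd-schneider-ideate`, seat `door-c3` gen 10. PARTITION: board row B6 ∩ X3 ∩ sst-twist, r = 1,
(G-ord, `e = 2`) half; algebra for crux r3's last untyped input (`KYRead.KYReadCHValue`): Keller–Yin
Thm. 3.5.1 (iii) in branch currency (`thm351_charIdeal_eq_branch_OPEN`, PREPRINT) says EVERY `μ = 0`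
branch frame `L` of `(f′, χ_ε)` generates `Char_Λ(𝔛)·R₀⟦T⟧`; with the `μ`-clause
(`thm351_mu_zero_branch_OPEN`) so does Castella–Hsieh's own frame `L_CH`; hence `(L) = (L_CH)`,
`L = U·L_CH` with `U ∈ R₀⟦T⟧ˣ`, and the VALUE at the trivial character transfers up to the unit `U(0)`:
`L(𝟙) = U(0)·L_CH(𝟙)` (`exists_hasValueAt_zero_unit_mul_of_span_eq`). With the descent of the
logarithm (`…KYReadLogDescent.lean`) and the embedding compatibility (`…KYReadEmbAtCompat.lean`) this
is all the glue between a typed Castella–Hsieh value formula at CH's frame (cite item wi-73260) and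
`KYReadCHValue` (value with INTEGRAL cofactor at every `μ = 0` frame). Closes nothing; BSD not advanced.

References: Washington, *Cyclotomic Fields* §7.1 (units of `𝒪⟦T⟧`, Weierstrass preparation);
Castella, Camb. J. Math. 6 (2018) §2.2 (values at `𝟙` as constant terms).
-/

noncomputable section

open scoped Classical

open PowerSeries Literature.NumberTheory.EllipticCurves

set_option linter.dupNamespace false
set_option autoImplicit false

namespace Summit.BirchSwinnertonDyer.BirchSwinnertonDyer.Theorems.SchneiderFree.KYRead.LogDescent

variable {p : ℕ} [Fact p.Prime]

/-- **Value transfer along an equality of principal ideals of `R₀⟦T⟧`**: if `(L) = (L′)` then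
`L = U·L′` for a unit `U` of `R₀⟦T⟧` (`R₀⟦T⟧` is a domain), and the value at the trivial character
(= the constant term) satisfies `L(𝟙) = U(0)·L′(𝟙)` with `U(0) ∈ R₀ˣ`.
[cite: Washington1997, §7.1 (units of 𝒪⟦T⟧ are the series with unit constant term)]
[cite: Castella2018, §2.2 (the value at 𝟙 is the constant term)] -/
theorem exists_hasValueAt_zero_unit_mul_of_span_eq {L L' : UnrSeries p}
    (h : Ideal.span {L} = Ideal.span {L'}) {v : ℂ_[p]} (hv : L'.HasValueAt 0 v) :
    ∃ U : (unrIntegers p)ˣ, L.HasValueAt 0 (((U : unrIntegers p) : ℂ_[p]) * v) := by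
  obtain ⟨u, hu⟩ := Ideal.span_singleton_eq_span_singleton.mp h.symm
  -- `L = L' * u` with `u` a unit of `R₀⟦T⟧`; its constant term is a unit of `R₀`
  have hU : IsUnit (PowerSeries.constantCoeff (u : UnrSeries p)) :=
    PowerSeries.isUnit_constantCoeff _ u.isUnit
  refine ⟨hU.unit, ?_⟩
  rw [UnrSeries.eq_constantCoeff_of_hasValueAt_zero hv, ← Subring.coe_mul, IsUnit.unit_spec,
    mul_comm, ← map_mul, hu]
  exact L.hasValueAt_zero

/-- **Integral cofactors transfer**: if `(L) = (L′)` and `L′(𝟙) = u′·X` with `u′ ∈ R₀`, then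
`L(𝟙) = u·X` with `u = U(0)·u′ ∈ R₀`. [cite: Washington1997, §7.1] [cite: Castella2018, §2.2] -/
theorem exists_hasValueAt_zero_mul_of_span_eq {L L' : UnrSeries p}
    (h : Ideal.span {L} = Ideal.span {L'}) (u' : unrIntegers p) {X : ℂ_[p]}
    (hv : L'.HasValueAt 0 (((u' : unrIntegers p) : ℂ_[p]) * X)) :
    ∃ u : unrIntegers p, L.HasValueAt 0 (((u : unrIntegers p) : ℂ_[p]) * X) := by
  obtain ⟨U, hU⟩ := exists_hasValueAt_zero_unit_mul_of_span_eq h hv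
  refine ⟨(U : unrIntegers p) * u', ?_⟩
  rwa [Subring.coe_mul, mul_assoc]

end Summit.BirchSwinnertonDyer.BirchSwinnertonDyer.Theorems.SchneiderFree.KYRead.LogDescent

end
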